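import Summits.CriticalPhenomena.PercolationContinuityZ3.Theorems.PercNearOneGluingNoHeavyLowerTailSahiLatinZeroBottomFactor

/-!
# `NoHeavyLowerTail` (crux stmt-CriticalPhenomena-4575), Sahi programme (prim-master-conj gen 50): the FIBREWISE RELAXATION of the grid
# invariant — exact along a distinguished block `W`, pointwise along the rest (`grid4_of_fibrewise`)

Support file (`--supports stmt-CriticalPhenomena-4575`; one small definition (`cofib`) + proofs, no `sorry`, standard axioms).  Memo
`run/shared/lean/prim/prim-l12/FROM-prim-master-conj-g50-GENERAL-CORE.md` §§7–8.  Nothing here asserts the crux, Kahn's conjecture or (C¼).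

THE MATHEMATICS.  gen 49's pointwise relaxation `grid4_of_pointwise` drops ALL up-closure of the four nested sets `H_SS ⊇ H_SO, H_OS ⊇ H_OO`; it proves
the grid invariant on cores but fails as soon as a block carries a prime (memo §5).  The intermediate relaxation of this file keeps up-closure EXACTLY
along a distinguished block `W` and drops it only across the complementary block `V`: for a point `η ∈ [3]^V` the CO-FIBRES
`J_XY(η) = {w ∈ [3]^W : (w,η) ∈ H_XY}` are nested up-sets of `[3]^W` inheriting the forced memberships, and
   `𝒢 = Σ_η Σ_XY Σ_{w ∈ J_XY(η)} dXY(w,η)`.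
Hence (`grid4_of_fibrewise`): if a function `m : [3]^V → ℤ` with `Σ_η m(η) ≥ 0` bounds from below, for every `η`, the `W`-sum for EVERY admissible
nested family of up-sets of `[3]^W`, then `Grid4` holds.  For `W` a single coordinate the admissible families are threshold tuples (a finite DP) —
the tool for the THRESHOLD-RELAXED BRIDGE `P = [x₀=2] ⊂ P′ = [x₀≥1]` (`…SahiLatinZeroBottomRelaxedBridge`), the first zero-bottom instance with a
NON-PRIVATE cut. [this work]
-/

namespace Summit.CriticalPhenomena.PercolationContinuityZ3.Theorems.SahiLatin

open Finset

variable {W V : Type*} [Fintype W] [DecidableEq W] [Fintype V] [DecidableEq V]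

/-! ## §1  Co-fibres -/

/-- The co-fibre of `H ⊆ [3]^{W ⊕ V}` over a point `η` of the second block: `{w : (w, η) ∈ H}`. [this work] -/
def cofib (H : Finset (Pt (W ⊕ V))) (η : Pt V) : Finset (Pt W) := univ.filter fun w => Sum.elim w η ∈ H

omit [DecidableEq V] in
/-- Membership in a co-fibre. [this work] -/
@[simp] theorem mem_cofib {H : Finset (Pt (W ⊕ V))} {η : Pt V} {w : Pt W} : w ∈ cofib H η ↔ Sum.elim w η ∈ H := by
  simp [cofib]

omit [DecidableEq V] in
/-- Co-fibres of an up-set are up-sets. [this work] -/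
theorem isUpperSet_cofib {H : Finset (Pt (W ⊕ V))} (hH : IsUpperSet (H : Set (Pt (W ⊕ V)))) (η : Pt V) :
    IsUpperSet ((cofib H η : Finset (Pt W)) : Set (Pt W)) := by
  intro w w' hww' hw
  rw [mem_coe, mem_cofib] at hw ⊢
  exact hH (elim_le_elim_iff.2 ⟨hww', le_rfl⟩) hw

omit [DecidableEq V] in
/-- Co-fibres are monotone in the set. [this work] -/
theorem cofib_subset_cofib {H H' : Finset (Pt (W ⊕ V))} (h : H ⊆ H') (η : Pt V) : cofib H η ⊆ cofib H' η := by
  intro w hw; rw [mem_cofib] at hw ⊢; exact h hw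

/-- **A sum over `H` is a sum over its co-fibres.** [this work] -/
theorem sum_mem_eq_sum_cofib (H : Finset (Pt (W ⊕ V))) (f : Pt (W ⊕ V) → ℤ) :
    ∑ u ∈ H, f u = ∑ η : Pt V, ∑ w ∈ cofib H η, f (Sum.elim w η) := by
  have e : ∑ u ∈ H, f u = ∑ u, (if u ∈ H then f u else 0) := by
    rw [← sum_filter, filter_mem_eq_inter, univ_inter]
  rw [e, sum_pt_sum_eq, sum_comm]
  refine sum_congr rfl fun η _ => ?_
  rw [cofib, sum_filter]

/-! ## §2  The fibrewise relaxation -/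

/-- **Fibrewise relaxation** (exact along `W`, pointwise along `V`): a lower bound `m(η)`, valid at every `η ∈ [3]^V` for every admissible nested family of
up-sets of `[3]^W`, with nonnegative total, gives `Grid4 P b Q c`. [this work] -/
theorem grid4_of_fibrewise {P b Q c : Finset (Pt (W ⊕ V))} (m : Pt V → ℤ) (hm : 0 ≤ ∑ η, m η)
    (h : ∀ (η : Pt V) (JSS JSO JOS JOO : Finset (Pt W)),
      IsUpperSet (JSS : Set (Pt W)) → IsUpperSet (JSO : Set (Pt W)) → IsUpperSet (JOS : Set (Pt W)) → IsUpperSet (JOO : Set (Pt W)) →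
      JOO ⊆ JSO → JOO ⊆ JOS → JSO ⊆ JSS → JOS ⊆ JSS →
      (∀ w, Sum.elim w η ∈ P ∪ Q → w ∈ JSS) → (∀ w, Sum.elim w η ∈ P → w ∈ JSO) → (∀ w, Sum.elim w η ∈ Q → w ∈ JOS) →
      m η ≤ ∑ w ∈ JSS, dSS P b Q c (Sum.elim w η) + ∑ w ∈ JSO, dSO P b Q c (Sum.elim w η)
            + ∑ w ∈ JOS, dOS P b Q c (Sum.elim w η) + ∑ w ∈ JOO, dOO P b Q c (Sum.elim w η)) :
    Grid4 P b Q c := by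
  intro HSS HSO HOS HOO u1 u2 u3 u4 n1 n2 n3 n4 f1 f2 f3
  rw [cSS_eq_sum, cSO_eq_sum, cOS_eq_sum, cOO_eq_sum, sum_mem_eq_sum_cofib, sum_mem_eq_sum_cofib, sum_mem_eq_sum_cofib,
    sum_mem_eq_sum_cofib, ← sum_add_distrib, ← sum_add_distrib, ← sum_add_distrib]
  refine le_trans hm (sum_le_sum fun η _ => ?_)
  exact h η (cofib HSS η) (cofib HSO η) (cofib HOS η) (cofib HOO η) (isUpperSet_cofib u1 η) (isUpperSet_cofib u2 η)
    (isUpperSet_cofib u3 η) (isUpperSet_cofib u4 η) (cofib_subset_cofib n1 η) (cofib_subset_cofib n2 η) (cofib_subset_cofib n3 η)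
    (cofib_subset_cofib n4 η) (fun w hw => mem_cofib.2 (f1 hw)) (fun w hw => mem_cofib.2 (f2 hw)) (fun w hw => mem_cofib.2 (f3 hw))

end Summit.CriticalPhenomena.PercolationContinuityZ3.Theorems.SahiLatin
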